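import Mathlib.Analysis.Normed.Algebra.MatrixExponential
import Mathlib.Analysis.SpecialFunctions.Exponential
import Mathlib.Analysis.Calculus.Deriv.Mul
import Mathlib.Analysis.Calculus.Deriv.Shift
import Mathlib.Analysis.Calculus.MeanValue
import HarnessLib

/-!
# `det (exp X) = exp (tr X)` for matrices over a commutative Banach algebra

For a square matrix `X` with entries in a complete normed commutative `ℝ`-algebra `A` (with
`ℚ`-algebra structure, as required by Mathlib's exponential), the determinant of the matrix
exponential is the exponential of the trace:

* `Literature.Analysis.Matrix.det_exp_eq_exp_trace` — **`det (exp X) = exp (tr X)`**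
  (Liouville's formula / Jacobi's formula at the identity).

Proof (the one-parameter-group argument, e.g. Hall, *Lie Groups, Lie Algebras, and
Representations* (2nd ed., 2015), Thm. 2.12; Knapp, *Lie Groups Beyond an Introduction*, 0.§2,
Prop. 0.11 (e)): `f(t) = det (exp tX)` and `g(t) = exp (t tr X)` are one-parameter groups in
`A`, so `f'(t) = f(t) f'(0)` and `g'(t) = g(t) tr X`; and `f'(0) = tr X` by differentiating the
Leibniz expansion `det M = ∑_σ ε_σ ∏ᵢ M_{σ i, i}` entrywise at `M = exp (0 · X) = 1`
(`hasDerivAt_det_exp_smul_zero`: only `σ = 1` survives, a non-trivial permutation moving at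
least two indices). Hence `t ↦ f(t) g(-t)` has vanishing derivative, is constant `= 1`, and
`f = g`.

Everything is proved; there are no definitions. (Mathlib has the matrix exponential
`Matrix.exp_*`, `Matrix.isUnit_exp`, but not this determinant formula.)

## References

* B. C. Hall, *Lie Groups, Lie Algebras, and Representations*, 2nd ed., GTM 222 (2015), Thm. 2.12.
* A. W. Knapp, *Lie Groups Beyond an Introduction*, 2nd ed. (2002), 0.§2, Prop. 0.11.
-/

noncomputable section

open NormedSpace Matrix Equiv

namespace Literature.Analysis.Matrix

variable {A : Type*} [NormedCommRing A] [NormedAlgebra ℚ A] [NormedAlgebra ℝ A] [CompleteSpace A]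
  {N : Type*} [Fintype N] [DecidableEq N]

omit [NormedAlgebra ℚ A] [NormedAlgebra ℝ A] [CompleteSpace A] in
open scoped Matrix.Norms.Operator in
/-- Entries are bounded by the `L^∞`-operator norm: `‖M i j‖ ≤ ‖M‖`. [folklore] -/
theorem norm_apply_le_linfty_opNorm (M : Matrix N N A) (i j : N) : ‖M i j‖ ≤ ‖M‖ := by
  have h : ‖M i j‖₊ ≤ ‖M‖₊ := by
    rw [linfty_opNNNorm_def]
    exact (Finset.single_le_sum (f := fun j => ‖M i j‖₊) (fun _ _ => zero_le)
      (Finset.mem_univ j)).trans (Finset.le_sup (f := fun i => ∑ j, ‖M i j‖₊) (Finset.mem_univ i))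
  exact_mod_cast h

-- As in `Mathlib/Analysis/Normed/Algebra/MatrixExponential.lean`: the scoped `L∞`-operator normed
-- ring structure on matrices is only reducibly-defeq to the Pi uniformity, so `CompleteSpace`
-- and the analytic facts about `exp` need this setting.
omit [NormedAlgebra ℚ A] in
set_option backward.isDefEq.respectTransparency false in
open scoped Matrix.Norms.Operator in
/-- **The entries of `t ↦ exp (t X)` are differentiable**, with derivative `(exp (tX) X)_{ij}`.
Knapp 2002, 0.§2, Prop. 0.11 (d). [folklore] -/
theorem hasDerivAt_exp_smul_apply (X : Matrix N N A) (i j : N) (t : ℝ) :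
    HasDerivAt (fun u : ℝ => (exp (u • X)) i j) ((exp (t • X) * X) i j) t := by
  -- the entry `(i, j)` as a continuous linear map for the operator norm
  let E : Matrix N N A →ₗ[ℝ] A :=
    { toFun := fun M => M i j
      map_add' := fun _ _ => rfl
      map_smul' := fun _ _ => rfl }
  let Ec : Matrix N N A →L[ℝ] A := E.mkContinuous 1 fun M => by
    rw [one_mul]; exact norm_apply_le_linfty_opNorm M i j
  have h := hasDerivAt_exp_smul_const (𝕂 := ℝ) X t
  exact Ec.hasFDerivAt.comp_hasDerivAt t h

omit [NormedAlgebra ℚ A] in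
/-- **`d/dt|_{t=0} det (exp tX) = tr X`** (Jacobi's formula at the identity): differentiate the
Leibniz expansion entrywise at `exp 0 = 1`; for `σ ≠ 1` every term `∏_{j ≠ i} δ_{σ j, j} X_{σ i, i}`
vanishes since `σ` moves some `j ≠ i`. Hall 2015, Thm. 2.12; Knapp 2002, Prop. 0.11 (e). [folklore] -/
theorem hasDerivAt_det_exp_smul_zero (X : Matrix N N A) :
    HasDerivAt (fun u : ℝ => (exp (u • X)).det) X.trace 0 := by
  classical
  have hentry : ∀ k l : N, HasDerivAt (fun u : ℝ => (exp (u • X)) k l) (X k l) 0 := by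
    intro k l
    have h := hasDerivAt_exp_smul_apply X k l 0
    rwa [zero_smul, exp_zero, one_mul] at h
  -- derivative of each Leibniz term
  have hterm : ∀ σ : Perm N, HasDerivAt (fun u : ℝ => ((Perm.sign σ : ℤ) : A) * ∏ i, (exp (u • X)) (σ i) i)
      (((Perm.sign σ : ℤ) : A) * ∑ i, (∏ j ∈ Finset.univ.erase i, (1 : Matrix N N A) (σ j) j) • X (σ i) i)
      0 := by
    intro σ
    have hp := HasDerivAt.fun_finsetProd (u := Finset.univ) (x := (0 : ℝ))
      (f := fun i u => (exp (u • X)) (σ i) i) (f' := fun i => X (σ i) i) (fun i _ => hentry (σ i) i)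
    simp only [zero_smul, exp_zero] at hp
    exact hp.const_mul _
  have hsum := HasDerivAt.fun_sum (u := Finset.univ) fun σ (_ : σ ∈ Finset.univ) => hterm σ
  have hfun : (fun u : ℝ => (exp (u • X)).det) =
      fun u => ∑ σ : Perm N, ((Perm.sign σ : ℤ) : A) * ∏ i, (exp (u • X)) (σ i) i := by
    funext u; rw [det_apply']
  -- evaluation of the derivative: only `σ = 1` contributes
  have hval : (∑ σ ∈ (Finset.univ : Finset (Perm N)), ((Perm.sign σ : ℤ) : A) *
      ∑ i, (∏ j ∈ Finset.univ.erase i, (1 : Matrix N N A) (σ j) j) • X (σ i) i) = X.trace := by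
    rw [Finset.sum_eq_single (1 : Perm N)]
    · rw [Perm.sign_one, Units.val_one, Int.cast_one, one_mul]
      have h1 : ∀ i : N, (∏ j ∈ Finset.univ.erase i, (1 : Matrix N N A) ((1 : Perm N) j) j) = 1 :=
        fun i => Finset.prod_eq_one fun j _ => one_apply_eq j
      rw [Finset.sum_congr rfl fun i _ => by rw [h1 i, one_smul]]
      rfl
    · intro σ _ hσ
      refine mul_eq_zero_of_right _ (Finset.sum_eq_zero fun i _ => ?_)
      -- some `j ≠ i` is moved by `σ`
      obtain ⟨j, hji, hj⟩ : ∃ j, j ≠ i ∧ σ j ≠ j := by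
        obtain ⟨j₀, hj₀⟩ : ∃ j₀, σ j₀ ≠ j₀ :=
          not_forall.mp fun h => hσ (Equiv.ext h)
        by_cases hji : j₀ = i
        · subst hji
          exact ⟨σ j₀, hj₀, fun h => hj₀ (σ.injective h)⟩
        · exact ⟨j₀, hji, hj₀⟩
      rw [Finset.prod_eq_zero (f := fun j => (1 : Matrix N N A) (σ j) j)
        (Finset.mem_erase.2 ⟨hji, Finset.mem_univ j⟩) (one_apply_ne hj), zero_smul]
    · intro h; exact absurd (Finset.mem_univ _) h
  rw [hfun]
  exact hsum.congr_deriv hval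

/-- **`det (exp X) = exp (tr X)`** for a square matrix over a complete normed commutative
`ℝ`-algebra (Liouville's formula). Hall 2015, Thm. 2.12; Knapp 2002, 0.§2, Prop. 0.11 (e). [folklore] -/
theorem det_exp_eq_exp_trace (X : Matrix N N A) : (exp X).det = exp X.trace := by
  -- the one-parameter groups `f(t) = det (exp tX)` and `g(t) = exp (t tr X)`
  set f : ℝ → A := fun u => (exp (u • X)).det with hf
  set g : ℝ → A := fun u => exp (u • X.trace) with hg
  have hfmul : ∀ s t, f (s + t) = f s * f t := fun s t => by
    simp only [hf, add_smul]
    rw [Matrix.exp_add_of_commute _ _ (((Commute.refl X).smul_left s).smul_right t), det_mul]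
  have hf0 : HasDerivAt f X.trace 0 := hasDerivAt_det_exp_smul_zero X
  have hf' : ∀ t, HasDerivAt f (f t * X.trace) t := by
    intro t
    have h0' : HasDerivAt f X.trace (t - t) := by rwa [sub_self]
    have h1 : HasDerivAt (fun u => f t * f (u - t)) (f t * X.trace) t :=
      (HasDerivAt.comp_sub_const t t h0').const_mul (f t)
    refine h1.congr_of_eventuallyEq (Filter.Eventually.of_forall fun u => ?_)
    change f u = f t * f (u - t)
    rw [← hfmul, add_sub_cancel]
  have hg' : ∀ t, HasDerivAt g (g t * X.trace) t := fun t =>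
    hasDerivAt_exp_smul_const (𝕂 := ℝ) X.trace t
  have hgn : ∀ t, HasDerivAt (fun u => g (-u)) (-(g (-t) * X.trace)) t := fun t =>
    ((hg' (-t)).scomp t (hasDerivAt_neg t)).congr_deriv (neg_one_smul ℝ _)
  -- `h(t) = f(t) g(-t)` has zero derivative
  set h : ℝ → A := f * fun u => g (-u) with hh
  have hh' : ∀ t, HasDerivAt h 0 t := by
    intro t
    refine ((hf' t).mul (hgn t)).congr_deriv ?_
    rw [mul_comm (g (-t)) X.trace, mul_assoc, mul_neg, add_neg_cancel]
  have hconst : ∀ t, h t = h 0 :=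
    fun t => is_const_of_deriv_eq_zero (fun t => (hh' t).differentiableAt) (fun t => (hh' t).deriv) t 0
  have h0 : h 0 = 1 := by
    simp [hh, hf, hg]
  have hgg : ∀ t, g (-t) * g t = 1 := fun t => by
    simp only [hg, neg_smul]
    rw [← NormedSpace.exp_add_of_commute (Commute.neg_left (Commute.refl _)), neg_add_cancel,
      NormedSpace.exp_zero]
  have hfg : ∀ t, f t = g t := fun t => by
    have ht : f t * g (-t) = 1 := by
      have := hconst t
      rw [h0, hh, Pi.mul_apply] at this
      exact this
    calc f t = f t * (g (-t) * g t) := by rw [hgg, mul_one]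
      _ = g t := by rw [← mul_assoc, ht, one_mul]
  have := hfg 1
  simp only [hf, hg, one_smul] at this
  exact this

end Literature.Analysis.Matrix
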